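import Summits.AtomisticToContinuum.HydrodynamicLimit.Theorems.KineticFluxLdDecay.Negative.HTheoremMixtureStatics
import Summits.AtomisticToContinuum.HydrodynamicLimit.Theorems.CorrectorPressureDecay.Negative.Frame
import HarnessLib

/-!
# The macrostate-mixture witness — its reduced one-body law is a product law with a Gaussian-mixture
# velocity factor (crux `KineticFluxLdDecay`, stmt-AtomisticToContinuum-10967; line `h-theorem-dissipation-budget`)

Continuation of `…/Negative/HTheoremMixtureStatics.lean`. For the witness `ν = ½(G_N^{(1)} + G_N^{(2)})`
(`MixtureWitness.mixtureLaw`) we identify the reduced one-body law (`HTheorem.oneBodyLaw`, frame `θ = 1`,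
`u₀ = 0`) at EVERY time `t` along EVERY hard-sphere flow:

  `f_t = posLaw σ N ⊗ velMix`,  `velMix = ½ N(0, I) + ½ N(0, 2I) = γ · velMixDensity`,

where `posLaw σ N = (N+1)⁻¹ Σᵢ Law(xᵢ)` is the particle-averaged one-particle marginal of the configurational
Gibbs measure (`posGibbsMeasure`, the same at both temperatures) and
`velMixDensity w = ½ + ½ e^{-llr1 2 0 w}`. Ingredients: flow-invariance of the witness
(`MixtureWitness.map_flow_mixtureLaw`), the position/velocity disintegration of the homogeneous Gibbs measure
(`lintegral_localGibbsMeasure`: conditionally on the positions the velocities are i.i.d. `N(0, θ₁ I)`), and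
uniqueness of product measures on measurable rectangles (`Measure.prod_eq`).
-/

noncomputable section

open MeasureTheory ProbabilityTheory Set Filter InformationTheory
open scoped ENNReal NNReal

namespace Summit.AtomisticToContinuum.HydrodynamicLimit.Theorems.HTheorem

open Literature.MathematicalPhysics.KineticTheory (T3 V3 hsDiameter localGibbsLaw localGibbsMeasure localGibbsLaw_eq
  gaussMeasure posGibbsMeasure posWeight posPartition velMeasure zipConfig zipConfig_apply lintegral_localGibbsMeasure
  canonicalPartition_eq_posPartition isProbabilityMeasure_posGibbsMeasure withDensity_localMaxwellian_eq_gaussMeasure)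
open Literature.Analysis.FluidPDE (HardSphereFlow Config localMaxwellian)
open Summit.AtomisticToContinuum.HydrodynamicLimit.Theorems.KineticFluxLdDecayTilt (llr1 llrConfig)

namespace MixtureWitness

/-! ## The one-body objects of the witness -/

/-- The configurational Gibbs measure of the crux frame at activity `1` (position law of `N+1` hard spheres of
diameter `σ(N+1)^{-1/3}` on `𝕋³`; the position marginal of `G_N^{(θ₁)}` for EVERY temperature `θ₁`). -/
abbrev posGibbs (σ : ℝ) (N : ℕ) : Measure (Fin (N + 1) → T3) :=
  posGibbsMeasure (fun _ => (1 : ℝ)) (hsDiameter σ N) (N + 1)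

/-- The particle-averaged one-particle POSITION law `π̄_N = (N+1)⁻¹ Σᵢ Law(xᵢ)` of the configurational Gibbs
measure (a probability measure on `𝕋³` for `σ ≤ 1/2`; uniform by translation invariance, a fact not needed here). -/
def posLaw (σ : ℝ) (N : ℕ) : Measure T3 :=
  (((N + 1 : ℕ) : ℝ≥0∞)⁻¹) • ∑ i : Fin (N + 1), (posGibbs σ N).map (fun x => x i)

/-- The one-body VELOCITY law of the witness: the Gaussian mixture `½ N(0, I) + ½ N(0, 2I)`. -/
def velMix : Measure V3 :=
  (2⁻¹ : ℝ≥0∞) • gaussMeasure (0 : V3) 1 + (2⁻¹ : ℝ≥0∞) • gaussMeasure (0 : V3) 2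

/-- The density of `velMix` w.r.t. the standard Gaussian `γ`: `r(w) = ½ + ½ e^{-llr1 2 0 w}`
(`= ½ + ½ · 2^{-3/2} e^{‖w‖²/4}`). -/
def velMixDensity (w : V3) : ℝ :=
  2⁻¹ + 2⁻¹ * Real.exp (-llr1 2 0 w)

/-- `r > 0`. -/
theorem velMixDensity_pos (w : V3) : 0 < velMixDensity w := by
  unfold velMixDensity; positivity

/-- `r` is continuous. -/
theorem continuous_velMixDensity : Continuous velMixDensity := by
  unfold velMixDensity
  exact continuous_const.add (continuous_const.mul
    (Summit.AtomisticToContinuum.HydrodynamicLimit.Theorems.KineticFluxLdDecayTilt.continuous_llr1 two_pos 0).neg.rexp)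

/-- `velMix` is a probability law. -/
instance isProbabilityMeasure_velMix : IsProbabilityMeasure velMix := by
  refine ⟨?_⟩
  simp only [velMix, Measure.add_apply, Measure.smul_apply, measure_univ, smul_eq_mul, mul_one]
  exact ENNReal.inv_two_add_inv_two

/-- `posLaw` is a probability law (`σ ≤ 1/2`). -/
theorem isProbabilityMeasure_posLaw {σ : ℝ} (hσ2 : σ ≤ 1 / 2) (N : ℕ) : IsProbabilityMeasure (posLaw σ N) := by
  haveI : IsProbabilityMeasure (posGibbs σ N) :=
    isProbabilityMeasure_posGibbsMeasure continuous_const (fun _ => one_pos) hσ2 N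
  refine ⟨?_⟩
  simp only [posLaw, Measure.smul_apply, Measure.coe_finsetSum, Finset.sum_apply,
    Measure.map_apply (measurable_pi_apply _) MeasurableSet.univ, Set.preimage_univ, measure_univ,
    Finset.sum_const, Finset.card_univ, Fintype.card_fin, nsmul_eq_mul, mul_one, smul_eq_mul]
  exact ENNReal.inv_mul_cancel (by simp) (ENNReal.natCast_ne_top _)

/-! ## `N(0, I) = γ` (tree: `CorrectorPressureDecayNegative.gaussMeasure_zero_one`) and `N(0, 2I) = e^{-llr1 2 0} · γ`;
the mixture as a density -/

/-- `N(0, 2I) = e^{-llr1 2 0} · γ` (ratio of the two Maxwellian densities, `localMaxwellian_ref_eq`). -/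
theorem gaussMeasure_zero_two_eq_withDensity :
    gaussMeasure (0 : V3) 2 = (stdGaussian V3).withDensity fun w => ENNReal.ofReal (Real.exp (-llr1 2 0 w)) := by
  have hM1 : Measurable fun v : V3 => ENNReal.ofReal (localMaxwellian 1 2 (0 : V3) v) :=
    (Literature.MathematicalPhysics.KineticTheory.continuous_localMaxwellian 1 2 (0 : V3)).measurable.ennreal_ofReal
  have hM2 : Measurable fun w : V3 => ENNReal.ofReal (Real.exp (-llr1 2 0 w)) :=
    (Summit.AtomisticToContinuum.HydrodynamicLimit.Theorems.KineticFluxLdDecayTilt.continuous_llr1 two_pos 0).neg.rexp.measurable.ennreal_ofReal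
  rw [← Summit.AtomisticToContinuum.HydrodynamicLimit.Theorems.CorrectorPressureDecayNegative.gaussMeasure_zero_one, ← withDensity_localMaxwellian_eq_gaussMeasure two_pos (0 : V3),
    ← withDensity_localMaxwellian_eq_gaussMeasure one_pos (0 : V3), ← withDensity_mul _ ?_ hM2]
  · congr 1
    funext v
    simp only [Pi.mul_apply]
    rw [← ENNReal.ofReal_mul (Literature.MathematicalPhysics.KineticTheory.localMaxwellian_nonneg zero_le_one zero_le_one _ _),
      Summit.AtomisticToContinuum.HydrodynamicLimit.Theorems.KineticFluxLdDecayTilt.localMaxwellian_ref_eq two_pos (0 : V3) v,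
      mul_assoc, ← Real.exp_add, add_neg_cancel, Real.exp_zero, mul_one]
  · exact (Literature.MathematicalPhysics.KineticTheory.continuous_localMaxwellian 1 1 (0 : V3)).measurable.ennreal_ofReal

/-- The velocity mixture is `γ` with density `r = velMixDensity`. -/
theorem velMix_eq_withDensity :
    velMix = (stdGaussian V3).withDensity fun w => ENNReal.ofReal (velMixDensity w) := by
  have hM2 : Measurable fun w : V3 => ENNReal.ofReal (Real.exp (-llr1 2 0 w)) :=
    (Summit.AtomisticToContinuum.HydrodynamicLimit.Theorems.KineticFluxLdDecayTilt.continuous_llr1 two_pos 0).neg.rexp.measurable.ennreal_ofReal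
  have h : (fun w => ENNReal.ofReal (velMixDensity w)) =
      (fun _ => (2⁻¹ : ℝ≥0∞)) + (2⁻¹ : ℝ≥0∞) • fun w => ENNReal.ofReal (Real.exp (-llr1 2 0 w)) := by
    funext w
    simp only [velMixDensity, Pi.add_apply, Pi.smul_apply, smul_eq_mul]
    rw [ENNReal.ofReal_add (by norm_num) (by positivity), ENNReal.ofReal_mul (by norm_num),
      ENNReal.ofReal_inv_of_pos two_pos, ENNReal.ofReal_ofNat]
  rw [h, withDensity_add_left measurable_const, withDensity_const, withDensity_smul _ hM2,
    ← gaussMeasure_zero_two_eq_withDensity, ← Summit.AtomisticToContinuum.HydrodynamicLimit.Theorems.CorrectorPressureDecayNegative.gaussMeasure_zero_one, velMix]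

/-! ## One-particle rectangles under the Gibbs components and under the witness -/

/-- **One-particle rectangle formula**: under `G_N^{(θ₁)}` (activity `1`, drift `0`),
`P(xᵢ ∈ A, vᵢ ∈ B) = P_pos(xᵢ ∈ A) · N(0, θ₁ I)(B)` — positions and velocities are independent, the velocity of
each particle is `N(0, θ₁ I)`, and the position marginal does not depend on the temperature. -/
theorem gibbs_eval_preimage_prod {σ θ₁ : ℝ} (hθ₁ : 0 < θ₁) (N : ℕ) (Φ : Flow σ N) (i : Fin (N + 1))
    {A : Set T3} (hA : MeasurableSet A) {B : Set V3} (hB : MeasurableSet B) :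
    gibbs σ 1 θ₁ 0 N Φ ((fun z : Phase N => z i) ⁻¹' (A ×ˢ B)) =
      posGibbs σ N ((fun x => x i) ⁻¹' A) * gaussMeasure (0 : V3) θ₁ B := by
  rw [gibbs_eq]
  have hevm : Measurable fun z : Phase N => z i := measurable_pi_apply i
  have hS : MeasurableSet ((fun z : Phase N => z i) ⁻¹' (A ×ˢ B)) := hevm (hA.prod hB)
  have hSA : MeasurableSet ((fun x : Fin (N + 1) → T3 => x i) ⁻¹' A) := (measurable_pi_apply i) hA
  have hSB : MeasurableSet ((fun v : Fin (N + 1) → V3 => v i) ⁻¹' B) := (measurable_pi_apply i) hB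
  rw [← lintegral_indicator_one hS,
    lintegral_localGibbsMeasure continuous_const continuous_const continuous_const
      (fun _ => zero_le_one) (fun _ => hθ₁) σ N (measurable_one.indicator hS)]
  have hind : ∀ (x : Fin (N + 1) → T3) (v : Fin (N + 1) → V3),
      ((fun z : Phase N => z i) ⁻¹' (A ×ˢ B)).indicator (1 : Phase N → ℝ≥0∞) (zipConfig (x, v)) =
        ((fun x : Fin (N + 1) → T3 => x i) ⁻¹' A).indicator 1 x *
          ((fun v : Fin (N + 1) → V3 => v i) ⁻¹' B).indicator 1 v := by
    intro x v
    by_cases hx : x i ∈ A <;> by_cases hv : v i ∈ B <;>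
      simp [Set.indicator, Set.mem_preimage, zipConfig_apply, Set.mem_prod, hx, hv]
  have hvel : ∀ x : Fin (N + 1) → T3, velMeasure (fun _ => (0 : V3)) (fun _ => θ₁) x =
      Measure.pi (fun _ : Fin (N + 1) => gaussMeasure (0 : V3) θ₁) := fun x => rfl
  have hinner : ∀ x : Fin (N + 1) → T3,
      ∫⁻ v, ((fun z : Phase N => z i) ⁻¹' (A ×ˢ B)).indicator (1 : Phase N → ℝ≥0∞) (zipConfig (x, v))
          ∂velMeasure (fun _ => (0 : V3)) (fun _ => θ₁) x =
        ((fun x : Fin (N + 1) → T3 => x i) ⁻¹' A).indicator 1 x * gaussMeasure (0 : V3) θ₁ B := by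
    intro x
    simp_rw [hind x]
    rw [lintegral_const_mul _ (measurable_one.indicator hSB), lintegral_indicator_one hSB, hvel x,
      (measurePreserving_eval (fun _ : Fin (N + 1) => gaussMeasure (0 : V3) θ₁) i).measure_preimage
        hB.nullMeasurableSet]
  simp_rw [hinner, ← mul_assoc]
  rw [canonicalPartition_eq_posPartition continuous_const continuous_const continuous_const
      (fun _ => zero_le_one) (fun _ => hθ₁)]
  have hmeas : Measurable fun x : Fin (N + 1) → T3 =>
      ENNReal.ofReal ((posPartition (fun _ => (1 : ℝ)) (hsDiameter σ N) (N + 1))⁻¹ *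
          posWeight (fun _ => (1 : ℝ)) (hsDiameter σ N) (N + 1) x) *
        ((fun x : Fin (N + 1) → T3 => x i) ⁻¹' A).indicator 1 x :=
    (measurable_const.mul (Literature.MathematicalPhysics.KineticTheory.measurable_posWeight
      continuous_const _ _)).ennreal_ofReal.mul (measurable_one.indicator hSA)
  rw [lintegral_mul_const _ hmeas]
  congr 1
  rw [posGibbs, posGibbsMeasure, withDensity_apply _ hSA, ← lintegral_indicator hSA]
  refine lintegral_congr fun x => ?_
  by_cases hx : x ∈ (fun x : Fin (N + 1) → T3 => x i) ⁻¹' A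
  · simp [hx]
  · simp [hx]

/-- The witness on one-particle rectangles: `ν(xᵢ ∈ A, vᵢ ∈ B) = P_pos(xᵢ ∈ A) · velMix(B)`. -/
theorem mixtureLaw_eval_preimage_prod (σ : ℝ) (N : ℕ) (Φ : Flow σ N) (i : Fin (N + 1))
    {A : Set T3} (hA : MeasurableSet A) {B : Set V3} (hB : MeasurableSet B) :
    mixtureLaw σ N Φ ((fun z : Phase N => z i) ⁻¹' (A ×ˢ B)) =
      posGibbs σ N ((fun x => x i) ⁻¹' A) * velMix B := by
  simp only [mixtureLaw, velMix, Measure.add_apply, Measure.smul_apply, smul_eq_mul,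
    gibbs_eval_preimage_prod one_pos N Φ i hA hB, gibbs_eval_preimage_prod two_pos N Φ i hA hB]
  ring

/-- The reduced one-body law of the witness on rectangles: `f_t(A × B) = π̄_N(A) · velMix(B)` for every `t`. -/
theorem oneBodyLaw_mixtureLaw_prod (σ : ℝ) (N : ℕ) (Φ : Flow σ N) (t : ℝ)
    {A : Set T3} (hA : MeasurableSet A) {B : Set V3} (hB : MeasurableSet B) :
    oneBodyLaw 1 0 Φ (mixtureLaw σ N Φ) t (A ×ˢ B) = posLaw σ N A * velMix B := by
  have hflow := Φ.measurable_flow t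
  have hterm : ∀ i : Fin (N + 1),
      (mixtureLaw σ N Φ).map (fun z => reducedCoord 1 0 (N + 1) i (Φ.flow t z)) (A ×ˢ B) =
        posGibbs σ N ((fun x => x i) ⁻¹' A) * velMix B := by
    intro i
    have hm : Measurable fun z : Phase N => reducedCoord 1 0 (N + 1) i (Φ.flow t z) := by
      rw [reducedCoord_one_zero]
      exact (measurable_pi_apply i).comp hflow
    rw [Measure.map_apply hm (hA.prod hB)]
    have hset : (fun z : Phase N => reducedCoord 1 0 (N + 1) i (Φ.flow t z)) ⁻¹' (A ×ˢ B) =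
        Φ.flow t ⁻¹' ((fun z : Phase N => z i) ⁻¹' (A ×ˢ B)) := by
      rw [reducedCoord_one_zero]; rfl
    rw [hset, (measurePreserving_flow_mixtureLaw σ N Φ t).measure_preimage
        ((measurable_pi_apply i) (hA.prod hB)).nullMeasurableSet,
      mixtureLaw_eval_preimage_prod σ N Φ i hA hB]
  have hmap : ∀ c : Fin (N + 1), ((posGibbs σ N).map (fun x => x c)) A = posGibbs σ N ((fun x => x c) ⁻¹' A) :=
    fun c => Measure.map_apply (measurable_pi_apply c) hA
  simp only [oneBodyLaw, Measure.smul_apply, Measure.coe_finsetSum, Finset.sum_apply, hterm, smul_eq_mul,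
    posLaw, hmap, Finset.sum_mul, mul_assoc]

/-- **The reduced one-body law of the witness is the product law `π̄_N ⊗ velMix`** at every time, along every
hard-sphere flow (`σ ≤ 1/2`). -/
theorem oneBodyLaw_mixtureLaw {σ : ℝ} (hσ2 : σ ≤ 1 / 2) (N : ℕ) (Φ : Flow σ N) (t : ℝ) :
    oneBodyLaw 1 0 Φ (mixtureLaw σ N Φ) t = (posLaw σ N).prod velMix := by
  haveI := isProbabilityMeasure_posLaw hσ2 N
  exact (Measure.prod_eq fun A B hA hB => oneBodyLaw_mixtureLaw_prod σ N Φ t hA hB).symm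

end MixtureWitness

end Summit.AtomisticToContinuum.HydrodynamicLimit.Theorems.HTheorem

end
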